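import Mathlib
import HarnessLib
import Summits.Ventures.LatticeQCDFlow.Scaling.U1WilsonIdentityFlowLaw

/-!
# LatticeQCDFlow / Scaling — the two Kullback–Leibler divergences of the UNTRAINED (identity-flow)
# U(1) Wilson sampler in closed form, on any finite complex and on the periodic torus:
# `D(Q‖P) = log(Z(β)/(2π)^{#links})`, `D(P‖Q) = Σ_p β_p⟨cos θ_p⟩_β − log(Z(β)/(2π)^{#links})`

HONEST FRAMING: exact (Metropolis-corrected) sampling algorithms for lattice gauge theory;
figures of merit are autocorrelation/cost numbers at stated couplings and volumes; no
continuum-physics claim.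

Venture `LatticeQCDFlow` (cell pub-lqcd), topic `Scaling`; FANOUT row 3 (`s0-u1-a`, S0-B
implementation A: the 2-d U(1) flow sampler, GEN-13).  NEW WORK of the cell (closed forms, no
numerics), the periodic-torus companion of row 3's `Scaling/U1IdentityFlowKL` (GEN-12, factorised
plaquettes).  Setting = row 5's `Scoring/SchwingerDysonLattice` / `U1CharacterExpansion` /
`U1TorusCharacterFormula` and row 3's `Scaling/U1WilsonIdentityFlowLaw` (imported: ESS and the
acceptance sandwich of the same sampler): `n + 1` link angles on `(0, 2π]^{n+1}`, plaquettes `p ∈ Ps` with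
integer incidences `inc p` and couplings `β_p`, `W_β(θ) = exp(Σ_p β_p cos θ_p)`, `Z(β) = ∫ W_β`; the
identity flow's model is the Haar density `q = (2π)^{−(n+1)}`, the target `p = W_β/Z(β)`.  The two
training losses of the cell's flows (reverse KL = the self-training loss up to `log Z`; forward KL) at
ZERO training are:

* §1 `integral_cos_u1PlaqAngle` — character orthogonality in real form: `∫_{(0,2π]^{n+1}} cos θ_p dθ = 0`
  for every plaquette with a nonzero incidence vector (row 5's `integral_u1TorusBox_cexp_sum`);
* §2 **`u1WilsonIdentityFlow_reverseKL`** — if every plaquette of `Ps` has a nonzero incidence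
  vector, `D(Q‖P) = ∫ q log(q/p) = log(Z(β)/(2π)^{n+1})` EXACTLY (the Haar mean of the action
  vanishes); **`u1WilsonIdentityFlow_forwardKL`** — on any complex,
  `D(P‖Q) = ∫ p log(p/q) = Σ_{p∈Ps} β_p·⟨cos θ_p⟩_β − log(Z(β)/(2π)^{n+1})` with row 5's Wilson
  expectation `u1WilsonExpect`;
* §3 the periodic `L₁ × L₂` torus at uniform coupling (`V = L₁L₂`; `torusInc_ne_zero_*`: every
  plaquette has a nonzero incidence vector as soon as `L₁ > 1` or `L₂ > 1`):
  **`u1TorusIdentityFlow_reverseKL`** `D(Q‖P) = log Σₖ I_{|k|}(β)^V` and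
  **`u1TorusIdentityFlow_forwardKL`**
  `D(P‖Q) = β·V·(Σₖ I_{|k|}^{V−1}(I_{|k−1|}+I_{|k+1|})/2)/(Σₖ I_{|k|}^V) − log Σₖ I_{|k|}(β)^V`
  (row 5's torus plaquette `torus_u1WilsonExpect_cos_plaq`).

Reading (value-free; no number of ours is computed or implied): on the torus the zero-training
calibration constants of both losses are the logarithm of the sector sum `Σₖ I_{|k|}(β)^V` (reverse)
and `βV⟨cos θ_P⟩ − log Σₖ I_{|k|}(β)^V` (forward), replacing `V log I₀(β)` and
`V(βI₁/I₀ − log I₀)(β)` of the factorised model.  NOT CLAIMED: any value at the cell's `(β, L)`;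
large-`V` asymptotics; nothing re-scored, SEALED.md untouched.
-/

noncomputable section

namespace Summit.Ventures.LatticeQCDFlow.Theory2

open MeasureTheory Real Set Finset
open Literature.Analysis.FunctionSpaces (besselI)
open Summit.Ventures.LatticeQCDFlow.Scoring

/-! ## §1 The Haar mean of a plaquette cosine vanishes -/

section General

variable {n : ℕ} {ι : Type*} (Ps : Finset ι) (inc : ι → Fin (n + 1) → ℤ) (βp : ι → ℝ)

/-- **`∫_{(0,2π]^{n+1}} cos θ_p dθ = 0`** for a plaquette with nonzero incidence vector (real part of
row 5's character orthogonality). [folklore] -/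
theorem integral_cos_u1PlaqAngle (p : ι) (hp : inc p ≠ 0) :
    ∫ θ in u1TorusBox (n + 1), Real.cos (u1PlaqAngle inc p θ) = 0 := by
  have h := integral_u1TorusBox_cexp_sum (n := n) (inc p)
  have hne : ¬ ∀ l, inc p l = 0 := fun h' => hp (funext fun l => by simpa using h' l)
  rw [if_neg hne] at h
  set F : (Fin (n + 1) → ℝ) → ℂ :=
    fun θ => Complex.exp ((∑ l, (inc p l : ℂ) * θ l) * Complex.I) with hF
  have hFc : Continuous F := by
    rw [hF]
    fun_prop
  have hFi : Integrable F (volume.restrict (u1TorusBox (n + 1))) := integrableOn_u1TorusBox' hFc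
  have hre : ∀ θ : Fin (n + 1) → ℝ, Real.cos (u1PlaqAngle inc p θ) = RCLike.re (F θ) := by
    intro θ
    have e : (∑ l, (inc p l : ℂ) * θ l) = ((u1PlaqAngle inc p θ : ℝ) : ℂ) := by
      unfold u1PlaqAngle
      push_cast
      rfl
    rw [hF, RCLike.re_to_complex]
    simp only
    rw [e, Complex.exp_ofReal_mul_I_re]
  simp_rw [hre]
  rw [integral_re hFi, h]
  simp

/-- `log W_β(θ) = Σ_p β_p cos θ_p`. [folklore] -/
theorem log_u1WilsonWeight (θ : Fin (n + 1) → ℝ) :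
    Real.log (u1WilsonWeight Ps inc βp θ) = ∑ p ∈ Ps, βp p * Real.cos (u1PlaqAngle inc p θ) := by
  unfold u1WilsonWeight
  exact Real.log_exp _

/-- The action is integrable on the torus box against any continuous density factor. [folklore] -/
theorem integrable_cos_u1PlaqAngle_mul {g : (Fin (n + 1) → ℝ) → ℝ} (hg : Continuous g) (p : ι) :
    Integrable (fun θ => Real.cos (u1PlaqAngle inc p θ) * g θ)
      (volume.restrict (u1TorusBox (n + 1))) :=
  integrableOn_u1TorusBox ((Real.continuous_cos.comp (continuous_u1PlaqAngle inc p)).mul hg)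

/-! ## §2 The reverse and forward KL of the identity flow on any finite complex -/

/-- **REVERSE KL of the identity flow**: if every plaquette has a nonzero incidence vector,
`D(Q‖P) = ∫ q log(q/p) = log(Z(β)/(2π)^{n+1})` for the Haar density `q = (2π)^{−(n+1)}` against the
Wilson density `p = W_β/Z(β)`. [ours] -/
theorem u1WilsonIdentityFlow_reverseKL (hinc : ∀ p ∈ Ps, inc p ≠ 0) :
    ∫ θ in u1TorusBox (n + 1), (1 / (2 * π) ^ (n + 1) : ℝ)
        * Real.log ((1 / (2 * π) ^ (n + 1)) / (u1WilsonWeight Ps inc βp θ / u1WilsonZ Ps inc βp))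
      = Real.log (u1WilsonZ Ps inc βp / (2 * π) ^ (n + 1)) := by
  have hZ := u1WilsonZ_pos Ps inc βp
  have hc : (0 : ℝ) < (2 * π) ^ (n + 1) := by positivity
  have e : ∀ θ, (1 / (2 * π) ^ (n + 1) : ℝ)
        * Real.log ((1 / (2 * π) ^ (n + 1)) / (u1WilsonWeight Ps inc βp θ / u1WilsonZ Ps inc βp))
      = (1 / (2 * π) ^ (n + 1)) * Real.log (u1WilsonZ Ps inc βp / (2 * π) ^ (n + 1))
        - (1 / (2 * π) ^ (n + 1)) * ∑ p ∈ Ps, βp p * Real.cos (u1PlaqAngle inc p θ) := by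
    intro θ
    have hW := u1WilsonWeight_pos Ps inc βp θ
    rw [show (1 / (2 * π) ^ (n + 1)) / (u1WilsonWeight Ps inc βp θ / u1WilsonZ Ps inc βp)
        = (u1WilsonZ Ps inc βp / (2 * π) ^ (n + 1)) / u1WilsonWeight Ps inc βp θ by field_simp,
      Real.log_div (div_pos hZ hc).ne' hW.ne', log_u1WilsonWeight]
    ring
  have hIcos : ∀ p ∈ Ps, Integrable (fun θ => βp p * Real.cos (u1PlaqAngle inc p θ))
      (volume.restrict (u1TorusBox (n + 1))) := fun p _ =>
    (integrableOn_u1TorusBox (Real.continuous_cos.comp (continuous_u1PlaqAngle inc p))).const_mul _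
  have hIsum : Integrable (fun θ => (1 / (2 * π) ^ (n + 1) : ℝ)
      * ∑ p ∈ Ps, βp p * Real.cos (u1PlaqAngle inc p θ)) (volume.restrict (u1TorusBox (n + 1))) :=
    (integrable_finsetSum _ hIcos).const_mul _
  haveI : IsFiniteMeasure ((volume : Measure (Fin (n + 1) → ℝ)).restrict (u1TorusBox (n + 1))) :=
    isFiniteMeasure_restrict.2 (volume_u1TorusBox_ne_top _)
  simp_rw [e]
  rw [integral_sub (integrable_const _) hIsum, setIntegral_const, volume_real_u1TorusBox, smul_eq_mul,
    integral_const_mul, integral_finsetSum _ hIcos,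
    sum_eq_zero fun p hp => by rw [integral_const_mul, integral_cos_u1PlaqAngle inc p (hinc p hp), mul_zero],
    mul_zero, sub_zero]
  field_simp

/-- **FORWARD KL of the identity flow**: on any finite complex,
`D(P‖Q) = ∫ p log(p/q) = Σ_{p∈Ps} β_p·⟨cos θ_p⟩_β − log(Z(β)/(2π)^{n+1})` (Wilson expectation of the
action minus the log-normalisation). [ours] -/
theorem u1WilsonIdentityFlow_forwardKL :
    ∫ θ in u1TorusBox (n + 1), (u1WilsonWeight Ps inc βp θ / u1WilsonZ Ps inc βp)
        * Real.log ((u1WilsonWeight Ps inc βp θ / u1WilsonZ Ps inc βp) / (1 / (2 * π) ^ (n + 1)))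
      = ∑ p ∈ Ps, βp p * u1WilsonExpect Ps inc βp (fun θ => Real.cos (u1PlaqAngle inc p θ))
        - Real.log (u1WilsonZ Ps inc βp / (2 * π) ^ (n + 1)) := by
  have hZ := u1WilsonZ_pos Ps inc βp
  have hc : (0 : ℝ) < (2 * π) ^ (n + 1) := by positivity
  have hWc := continuous_u1WilsonWeight Ps inc βp
  have e : ∀ θ, (u1WilsonWeight Ps inc βp θ / u1WilsonZ Ps inc βp)
        * Real.log ((u1WilsonWeight Ps inc βp θ / u1WilsonZ Ps inc βp) / (1 / (2 * π) ^ (n + 1)))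
      = (1 / u1WilsonZ Ps inc βp)
          * ∑ p ∈ Ps, βp p * (Real.cos (u1PlaqAngle inc p θ) * u1WilsonWeight Ps inc βp θ)
        - Real.log (u1WilsonZ Ps inc βp / (2 * π) ^ (n + 1))
          * (u1WilsonWeight Ps inc βp θ / u1WilsonZ Ps inc βp) := by
    intro θ
    have hW := u1WilsonWeight_pos Ps inc βp θ
    rw [show (u1WilsonWeight Ps inc βp θ / u1WilsonZ Ps inc βp) / (1 / (2 * π) ^ (n + 1))
        = u1WilsonWeight Ps inc βp θ / (u1WilsonZ Ps inc βp / (2 * π) ^ (n + 1)) by field_simp,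
      Real.log_div hW.ne' (div_pos hZ hc).ne', log_u1WilsonWeight, mul_sub]
    congr 1
    · rw [mul_sum, mul_sum]
      exact sum_congr rfl fun p _ => by ring
    · ring
  simp_rw [e]
  have hI : ∀ p ∈ Ps, Integrable (fun θ => βp p * (Real.cos (u1PlaqAngle inc p θ)
      * u1WilsonWeight Ps inc βp θ)) (volume.restrict (u1TorusBox (n + 1))) :=
    fun p _ => (integrable_cos_u1PlaqAngle_mul inc hWc p).const_mul _
  rw [integral_sub ((integrable_finsetSum _ hI).const_mul _)
      (((integrableOn_u1TorusBox hWc).div_const _).const_mul _),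
    integral_const_mul, integral_const_mul, integral_finsetSum _ hI, integral_div, ← u1WilsonZ,
    div_self hZ.ne', mul_one, mul_sum]
  congr 1
  refine sum_congr rfl fun p _ => ?_
  rw [integral_const_mul, u1WilsonExpect]
  field_simp

end General

/-! ## §3 The periodic `L₁ × L₂` torus at uniform coupling -/

section Torus

variable {L₁ L₂ : ℕ} [NeZero L₁] [NeZero L₂] {n : ℕ}
  (e : Fin 2 × (Fin L₁ × Fin L₂) ≃ Fin (n + 1)) (β : ℝ)

omit [NeZero L₁] in
/-- In `Fin L` with `L > 1`, `a + 1 ≠ a`. [folklore] -/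
theorem Fin.add_one_ne_self_of_one_lt {L : ℕ} [NeZero L] (hL : 1 < L) (a : Fin L) : a + 1 ≠ a := by
  intro h
  have h1 : (1 : Fin L) = 0 := by simpa using h
  have h2 := congrArg Fin.val h1
  rw [Fin.val_one', Fin.val_zero, Nat.one_mod_eq_one.mpr (by omega)] at h2
  exact one_ne_zero h2

/-- On a torus with `L₂ > 1` every plaquette has a nonzero incidence vector (its own direction-0
link enters with coefficient `1`). [ours] -/
theorem torusInc_ne_zero_of_lt_right (hL : 1 < L₂) (x : Fin L₁ × Fin L₂) : torusInc e x ≠ 0 := by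
  intro H
  have h := congrFun H (e (0, x))
  have hx : x ≠ (x.1, x.2 + 1) := fun h' => by
    have := congrArg Prod.snd h'
    exact Fin.add_one_ne_self_of_one_lt hL x.2 this.symm
  simp [torusInc, hx] at h

/-- On a torus with `L₁ > 1` every plaquette has a nonzero incidence vector (the direction-1 link at
`x + e₁` enters with coefficient `1`). [ours] -/
theorem torusInc_ne_zero_of_lt_left (hL : 1 < L₁) (x : Fin L₁ × Fin L₂) : torusInc e x ≠ 0 := by
  intro H
  have h := congrFun H (e (1, (x.1 + 1, x.2)))
  have hx : ((x.1 + 1, x.2) : Fin L₁ × Fin L₂) ≠ x := fun h' => by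
    have := congrArg Prod.fst h'
    exact Fin.add_one_ne_self_of_one_lt hL x.1 this
  simp [torusInc, hx] at h

/-- **REVERSE KL ON THE TORUS**: `D(Q‖P) = log Σₖ I_{|k|}(β)^{L₁L₂}` (any `L₁, L₂` not both `1`).
[ours] -/
theorem u1TorusIdentityFlow_reverseKL (hL : 1 < L₁ ∨ 1 < L₂) :
    ∫ θ in u1TorusBox (n + 1), (1 / (2 * π) ^ (n + 1) : ℝ)
        * Real.log ((1 / (2 * π) ^ (n + 1))
          / (u1WilsonWeight univ (torusInc e) (fun _ => β) θ / u1WilsonZ univ (torusInc e) (fun _ => β)))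
      = Real.log (∑' k : ℤ, besselI k.natAbs β ^ (L₁ * L₂)) := by
  have hinc : ∀ x ∈ (univ : Finset (Fin L₁ × Fin L₂)), torusInc e x ≠ 0 := fun x _ => by
    rcases hL with h | h
    · exact torusInc_ne_zero_of_lt_left e h x
    · exact torusInc_ne_zero_of_lt_right e h x
  rw [u1WilsonIdentityFlow_reverseKL univ (torusInc e) (fun _ => β) hinc, torus_u1WilsonZ_uniform,
    mul_div_cancel_left₀ _ (by positivity : (2 * π : ℝ) ^ (n + 1) ≠ 0)]

/-- **FORWARD KL ON THE TORUS**: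
`D(P‖Q) = β·L₁L₂·(Σₖ I_{|k|}^{L₁L₂−1}(I_{|k−1|}+I_{|k+1|})/2)/(Σₖ I_{|k|}^{L₁L₂}) − log Σₖ I_{|k|}(β)^{L₁L₂}`
— the Wilson mean of the action on the torus minus the log of the sector sum. [ours] -/
theorem u1TorusIdentityFlow_forwardKL :
    ∫ θ in u1TorusBox (n + 1),
        (u1WilsonWeight univ (torusInc e) (fun _ => β) θ / u1WilsonZ univ (torusInc e) (fun _ => β))
          * Real.log ((u1WilsonWeight univ (torusInc e) (fun _ => β) θ
              / u1WilsonZ univ (torusInc e) (fun _ => β)) / (1 / (2 * π) ^ (n + 1)))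
      = β * (L₁ * L₂) * ((∑' k : ℤ, besselI k.natAbs β ^ (L₁ * L₂ - 1) *
            ((besselI (k - 1).natAbs β + besselI (k + 1).natAbs β) / 2)) /
          ∑' k : ℤ, besselI k.natAbs β ^ (L₁ * L₂))
        - Real.log (∑' k : ℤ, besselI k.natAbs β ^ (L₁ * L₂)) := by
  rw [u1WilsonIdentityFlow_forwardKL univ (torusInc e) (fun _ => β), torus_u1WilsonZ_uniform,
    mul_div_cancel_left₀ _ (by positivity : (2 * π : ℝ) ^ (n + 1) ≠ 0)]
  congr 1
  simp_rw [torus_u1WilsonExpect_cos_plaq e β]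
  rw [sum_const, card_univ, Fintype.card_prod, Fintype.card_fin, Fintype.card_fin, nsmul_eq_mul]
  push_cast
  ring

end Torus

end Summit.Ventures.LatticeQCDFlow.Theory2

end
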